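import Literature.NumberTheory.LFunctions.MoebiusAutomaticFinalSyncPrep
import Literature.NumberTheory.LFunctions.AutomaticSequenceTransducer
import HarnessLib

/-!
# Base change `k ↦ k^p` for automata read from the most significant digit (Müllner 2017, Prop. 2.25, first step; proved)

Everything in this file is PROVED (plus one plain definition). Prop. 2.25 of C. Müllner,
*Automatic sequences fulfill the Sarnak conjecture* (Duke Math. J. 166 (2017)), replaces a base-`k`
automaton `Ā` with `δ̄(q̄₀, 0) = q̄₀` by its "`p`-th power" `A` over the alphabet
`{0, …, k^p − 1} ≅ {0,…,k−1}^p` ("`δ'` is the extension of `δ̄` from letters to words of length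
`p`"), which generates the same sequence ("as `δ̄(q̄₀,0) = q̄₀` ensures that adding leading zeros
does not change the output"). Here:

* `powδ k p δ` — the `p`-th power automaton: the letter `D < k^p` acts as the block `(D)_k^p`;
* `dfaoSeq_pow` — it generates the same sequence in base `k^p` (when `δ(q₀, 0) = q₀`, `p ≥ 1`);
* `IsAutomaticSeq.pow` — a `k`-automatic sequence is `k^p`-automatic (kernel inclusion), so the
  fact `mullner_moebius_automatic` may be attacked in any base `k^p`.

The group-theoretic half of Prop. 2.25 (`d(A_i) = k₀(A_i) = 1` for the final components of the
power automaton with `p = lcm(d k₀)`) needs Thm. 2.16 and is not formalised here.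

## References
* C. Müllner, Duke Math. J. 166 (2017), Prop. 2.25 and Cor. 2.26. [Mullner2017]
-/

noncomputable section

open Finset

namespace Literature.NumberTheory.LFunctions

section Pow

variable {σ : Type*}

/-- The `p`-th power of a base-`k` automaton: the base-`k^p` letter `D` acts as the block
`(D)_k^p` of `p` base-`k` digits (Müllner, proof of Prop. 2.25). [cite: Mullner2017, Prop. 2.25 (proof)] -/
def powδ (k p : ℕ) (δ : σ → ℕ → σ) : σ → ℕ → σ :=
  fun q D => wordAct δ (msbBlock k p D) q

/-- Reading base-`k^p` letters with the power automaton = reading the concatenated blocks.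
[folklore] -/
theorem foldl_powδ (k p : ℕ) (δ : σ → ℕ → σ) (L : List ℕ) (q : σ) :
    L.foldl (powδ k p δ) q = wordAct δ (L.map (msbBlock k p)).flatten q := by
  induction L generalizing q with
  | nil => rfl
  | cons D L ih =>
    rw [List.foldl_cons, ih, List.map_cons, List.flatten_cons, wordAct_append]
    rfl

/-- **Blocks of the base-`k^p` digits are the base-`k` padded word**: if `n` has `L` digits in
base `k^p` then the concatenation of the blocks `(D)_k^p` of its base-`k^p` digits (most
significant first) is `(n)_k^{pL}`. [folklore] -/
theorem flatten_map_msbBlock_digits {k p : ℕ} (hk : 2 ≤ k) (hp : 1 ≤ p) (n : ℕ) :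
    ((Nat.digits (k ^ p) n).reverse.map (msbBlock k p)).flatten =
      msbBlock k (p * (Nat.digits (k ^ p) n).length) n := by
  have hk1 : 1 < k := hk
  have hK : 2 ≤ k ^ p := by
    calc 2 ≤ k := hk
      _ = k ^ 1 := (pow_one k).symm
      _ ≤ k ^ p := Nat.pow_le_pow_right (by omega) hp
  induction n using Nat.strong_induction_on with
  | _ n ih =>
    rcases Nat.eq_zero_or_pos n with rfl | hn
    · simp [msbBlock, Nat.digitsAppend]
    · rw [Nat.digits_def' hK hn, List.reverse_cons, List.map_append, List.flatten_append,
        List.map_singleton, List.flatten_singleton, ih (n / k ^ p) (Nat.div_lt_self hn hK),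
        List.length_cons, Nat.mul_succ]
      have hlt : n / k ^ p < k ^ (p * (Nat.digits (k ^ p) (n / k ^ p)).length) := by
        rw [pow_mul]
        exact Nat.lt_base_pow_length_digits hK
      rw [← msbBlock_add hk1 hlt (Nat.mod_lt _ (by positivity)), Nat.div_add_mod]

/-- **Müllner 2017, Prop. 2.25 (first step): the power automaton generates the same sequence.**
For `δ(q₀, 0) = q₀` and `p ≥ 1`, reading the base-`k^p` digits with `powδ k p δ` gives the
sequence generated by `δ` in base `k`. [cite: Mullner2017, Prop. 2.25] -/
theorem dfaoSeq_pow {k p : ℕ} (hk : 2 ≤ k) (hp : 1 ≤ p) {δ : σ → ℕ → σ} {q₀ : σ}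
    (h0 : δ q₀ 0 = q₀) (τ : σ → ℂ) : dfaoSeq (k ^ p) (powδ k p δ) q₀ τ = dfaoSeq k δ q₀ τ := by
  funext n
  simp only [dfaoSeq]
  rw [foldl_powδ, flatten_map_msbBlock_digits hk hp, wordAct_def, foldl_msbBlock_eq_of_fix_zero h0]

/-- The power automaton still fixes the initial state on the letter `0`. [folklore] -/
theorem powδ_zero {k p : ℕ} {δ : σ → ℕ → σ} {q₀ : σ} (h0 : δ q₀ 0 = q₀) :
    powδ k p δ q₀ 0 = q₀ := by
  rw [powδ, wordAct_def, msbBlock, Nat.digitsAppend, Nat.digits_zero, List.nil_append,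
    List.length_nil, Nat.sub_zero, List.reverse_replicate]
  exact foldl_replicate_zero h0 p

end Pow

/-- **A `k`-automatic sequence is `k^p`-automatic** (`p ≥ 1`): the `k^p`-kernel is contained in the
`k`-kernel. Hence Müllner's theorem may be proved in any base `k^p` (Prop. 2.25).
[cite: Mullner2017, Prop. 2.25] -/
theorem IsAutomaticSeq.pow {k : ℕ} {a : ℕ → ℂ} (h : IsAutomaticSeq k a) {p : ℕ} (hp : 1 ≤ p) :
    IsAutomaticSeq (k ^ p) a := by
  refine h.subset ?_
  rintro g ⟨i, hi, r, hr, rfl⟩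
  refine ⟨p * i, Nat.one_le_iff_ne_zero.2 (Nat.mul_ne_zero (by omega) (by omega)), r, ?_, ?_⟩
  · rwa [pow_mul]
  · funext n
    rw [pow_mul]

end Literature.NumberTheory.LFunctions
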